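import Literature.Analysis.FluidPDE.GigaMiura2011DirectionGradientCriterion
import Summits.NavierStokesRegularity.NavierStokesRegularity.Theorems.ScaledTopAlignmentGigaMiuraDirectionGradient
import HarnessLib

/-!
# Route `ScaledTopAlignment`: discharge of the Literature statement of Giga–Miura 2011, Cor. 2.6
# (support for the deciding crux W3ᵐᵗ = `AprioriMostTimesBulkAlignment`, stmt-NavierStokesRegularity-19551)

The named fact `Literature.Analysis.FluidPDE.gigaMiura2011_directionGradient_typeI`
(`Literature/Analysis/FluidPDE/GigaMiura2011DirectionGradientCriterion.lean`: Type I +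
`∫₀ᵀ ‖∇ξ(t)‖²_{L^∞(Ω_d(t))} dt < ∞` ⇒ continuation past `T`; HUPS #956 p. 9) is, verbatim, the type
of the tree theorem `hasSmoothExtensionPast_of_directionGradient_sqIntegrable_typeI`
(`ScaledTopAlignmentGigaMiuraDirectionGradient`, the cell's Type-I zoom kit); this file records the
discharge BY NAME, so that the fact is proved for every importer (net debt of the statement file: 0).
WHAT THIS IS NOT: not NS regularity — a Type-I-conditional criterion from print; W3ᵐᵗ and the
residual NoTypeII (stmt-0056) are untouched.
-/

-- the summit and its single sub-problem share the name (CONVENTIONS §1), as in every Theorems file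
set_option linter.dupNamespace false

namespace Summit.NavierStokesRegularity.NavierStokesRegularity.Theorems

/-- **Giga–Miura 2011, Corollary 2.6 — the named Literature statement holds** (discharge of
`Literature.Analysis.FluidPDE.gigaMiura2011_directionGradient_typeI` by the tree theorem
`hasSmoothExtensionPast_of_directionGradient_sqIntegrable_typeI`).
[cite: GigaMiura2011, Cor. 2.6 with Rmk. 2.7 (§2.1; HUPS preprint #956 p. 9)] -/
theorem gigaMiura2011_directionGradient_typeI_holds :
    Literature.Analysis.FluidPDE.gigaMiura2011_directionGradient_typeI := by
  intro ν T hν hT u p hsol hLH hbdd hI hD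
  exact hasSmoothExtensionPast_of_directionGradient_sqIntegrable_typeI hν hT hsol hLH hbdd hI hD

end Summit.NavierStokesRegularity.NavierStokesRegularity.Theorems
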